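import Summits.KontsevichZagierPeriods.KontsevichZagierPeriods.Theorems.SoloInformedToricOpenCube
import Literature.NumberTheory.Transcendental.KZDirichletScaling
import HarnessLib

/-!
# The corner move `x ↦ 1 − x` inside the calculus

Solo programme `solo-KontsevichZagierPeriods-informed`, session s104 (closure properties, 4).

Cube-nondegeneracy (`SoloInformedCubeNondegenerate`) is adapted to singularities on the faces
through the ORIGIN; denominators such as the cubical multiple-zeta denominators `1 − x₀⋯xⱼ`, which
vanish at the far corner `(1, …, 1)`, become cube-nondegenerate after the **corner move**
`Φ(x) = 1 − x` (Kontsevich–Zagier's rule (2) with `|det Φ'| = 1`).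

* `soloInformedCornerMove`, an involution of the open cube, `ℚ`-semialgebraic, derivative `−id`;
* `soloInformedReflect n = bind₁ (j ↦ 1 − Xⱼ)` with `aeval x (reflect P) = aeval (Φ x) P`;
* `soloInformed_presentable_of_reflect_nondegenerate_open` / `…_nondegenerate`: `[(0,1)ⁿ, P/Q]`
  (resp. `[[0,1]ⁿ, P/Q]`) is presentable as soon as the reflected denominator `reflect Q` is
  cube-nondegenerate;
* the reflected prefix denominators `reflect (1 − x₀⋯xⱼ) = 1 − ∏_{i≤j} (1 − xᵢ)` are then
  arbitrary-subset zeta denominators (`soloInformed_cubeNondegenerate_subsetZeta`), which is how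
  the cube representations of multiple zeta values are treated in `SoloInformedToricMZVClass`.

References: M. Kontsevich, D. Zagier, *Periods* (2001) §1.2 rule (2); J. Ayoub, EMS Newsl. 91
(2014) §2.2.
-/

noncomputable section

open scoped BigOperators
open MeasureTheory Set
open Literature.NumberTheory.Transcendental Literature.NumberTheory.Transcendental.KZ
open Literature.ModelTheory.ExponentialFields (IsSemialgebraic)

namespace Summit.KontsevichZagierPeriods.KontsevichZagierPeriods.Theorems

variable {n : ℕ}

/-! ## The corner move `x ↦ 1 − x` -/

/-- The corner move `Φ(x) = (1 − x₀, …, 1 − x_{n-1})` of `ℝⁿ`. -/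
def soloInformedCornerMove (n : ℕ) (x : Fin n → ℝ) : Fin n → ℝ := fun j => 1 - x j

/-- The corner move is an involution. -/
theorem soloInformed_cornerMove_cornerMove (x : Fin n → ℝ) :
    soloInformedCornerMove n (soloInformedCornerMove n x) = x := by
  funext j
  simp [soloInformedCornerMove]

/-- The corner move is injective. -/
theorem soloInformed_cornerMove_injective : Function.Injective (soloInformedCornerMove n) :=
  fun x y h => by
    rw [← soloInformed_cornerMove_cornerMove x, h, soloInformed_cornerMove_cornerMove y]

/-- The corner move preserves the open cube. -/
theorem soloInformed_cornerMove_mem {x : Fin n → ℝ} (hx : x ∈ soloInformedOpenCube n) :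
    soloInformedCornerMove n x ∈ soloInformedOpenCube n := fun j =>
  ⟨by have := (hx j).2; simp only [soloInformedCornerMove]; linarith,
    by have := (hx j).1; simp only [soloInformedCornerMove]; linarith⟩

/-- The corner move maps the open cube onto itself. -/
theorem soloInformed_image_cornerMove :
    soloInformedCornerMove n '' soloInformedOpenCube n = soloInformedOpenCube n :=
  Subset.antisymm (image_subset_iff.2 fun _ hx => soloInformed_cornerMove_mem hx) fun x hx =>
    ⟨soloInformedCornerMove n x, soloInformed_cornerMove_mem hx,
      soloInformed_cornerMove_cornerMove x⟩

/-- The derivative of the corner move is `−id`. -/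
theorem soloInformed_hasFDerivAt_cornerMove (x : Fin n → ℝ) :
    HasFDerivAt (soloInformedCornerMove n) ((-1 : ℝ) • ContinuousLinearMap.id ℝ (Fin n → ℝ))
      x := by
  have h := (hasFDerivAt_const (fun _ : Fin n => (1 : ℝ)) x).sub (hasFDerivAt_id (𝕜 := ℝ) x)
  rw [zero_sub, ← neg_one_smul ℝ (ContinuousLinearMap.id ℝ (Fin n → ℝ))] at h
  exact h

/-- The corner move is a `ℚ`-semialgebraic map on every `ℚ`-semialgebraic set. -/
theorem soloInformed_isSemialgebraicMapOn_cornerMove {s : Set (Fin n → ℝ)}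
    (hs : IsSemialgebraic ℚ s) : IsSemialgebraicMapOn ℚ s (soloInformedCornerMove n) :=
  (isSemialgebraicMapOn_aeval hs fun j => (1 - MvPolynomial.X j : MvPolynomial (Fin n) ℚ)).congr
    fun x _ => by
      funext j
      simp [soloInformedCornerMove]

/-! ## Reflected polynomials -/

/-- The reflection `P ↦ P(1 − x)` of `ℚ[x₁, …, xₙ]` (an algebra endomorphism). -/
def soloInformedReflect (n : ℕ) : MvPolynomial (Fin n) ℚ →ₐ[ℚ] MvPolynomial (Fin n) ℚ :=
  MvPolynomial.bind₁ fun j => 1 - MvPolynomial.X j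

/-- Reflection of a variable. -/
theorem soloInformed_reflect_X (j : Fin n) :
    soloInformedReflect n (MvPolynomial.X j) = 1 - MvPolynomial.X j := by
  unfold soloInformedReflect
  rw [MvPolynomial.bind₁_X_right]

/-- Evaluating the reflected polynomial is evaluating at the corner-moved point. -/
theorem soloInformed_aeval_reflect (x : Fin n → ℝ) (P : MvPolynomial (Fin n) ℚ) :
    MvPolynomial.aeval x (soloInformedReflect n P) =
      MvPolynomial.aeval (soloInformedCornerMove n x) P := by
  unfold soloInformedReflect
  rw [MvPolynomial.aeval_bind₁]
  have h : (fun i => MvPolynomial.aeval x (1 - MvPolynomial.X i : MvPolynomial (Fin n) ℚ)) =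
      soloInformedCornerMove n x := by
    funext j
    simp [soloInformedCornerMove]
  rw [h]

/-! ## Presentability through the corner move -/

/-- **The corner move inside the calculus.**  If the reflected denominator `reflect Q` is
cube-nondegenerate, then every `IntegralRep` with domain `(0,1)ⁿ` and integrand `P/Q` is
presentable: rule (2) along `x ↦ 1 − x` (`|det| = 1`) turns it into `[(0,1)ⁿ, reflect P/reflect Q]`,
presentable by THEOREM ND on the open cube. [this work] -/
theorem soloInformed_presentable_of_reflect_nondegenerate_open (P Q : MvPolynomial (Fin n) ℚ)
    (hND : SoloInformedCubeNondegenerate (soloInformedReflect n Q)) (ρ : IntegralRep n)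
    (hρ : ρ.domain = soloInformedOpenCube n)
    (hρi : EqOn ρ.integrand (fun x => MvPolynomial.aeval x P / MvPolynomial.aeval x Q)
      (soloInformedOpenCube n)) :
    of ρ ∈ soloInformedPresentable := by
  have hQt : ∀ x ∈ soloInformedOpenCube n, MvPolynomial.aeval x (soloInformedReflect n Q) ≠ 0 :=
    fun x hx => soloInformed_aeval_ne_zero_of_nondegenerate hND fun i => ⟨(hx i).1, (hx i).2.le⟩
  have hint : IntegrableOn (fun x => MvPolynomial.aeval x P / MvPolynomial.aeval x Q)
      (soloInformedOpenCube n) := by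
    have h := ρ.integrableOn.congr_fun (fun x hx => hρi (by rwa [hρ] at hx))
      ρ.measurableSet_domain_holds
    rwa [hρ] at h
  have hint' : IntegrableOn (fun x => MvPolynomial.aeval x (soloInformedReflect n P) /
      MvPolynomial.aeval x (soloInformedReflect n Q)) (soloInformedOpenCube n) := by
    have hmeas : MeasurableSet (soloInformedOpenCube n) := hρ ▸ ρ.measurableSet_domain_holds
    have h := (integrableOn_image_iff_integrableOn_abs_det_fderiv_smul volume hmeas
      (fun x _ => (soloInformed_hasFDerivAt_cornerMove x).hasFDerivWithinAt)
      soloInformed_cornerMove_injective.injOn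
      (fun x => MvPolynomial.aeval x P / MvPolynomial.aeval x Q)).1
      (by rw [soloInformed_image_cornerMove]; exact hint)
    refine h.congr_fun (fun x _ => ?_) hmeas
    simp only [det_smul_id_fin, abs_pow, abs_neg, abs_one, one_pow, one_smul,
      soloInformed_aeval_reflect]
  -- rule (2) along the corner move
  set ρt := IntegralRep.ofRational (soloInformedOpenCube n) (soloInformedReflect n P)
      (soloInformedReflect n Q) (isSemialgebraic_soloInformedOpenCube n) hQt hint' with hρt
  have h2 : of ρt - of ρ ∈ relations := by
    refine changeOfVariablesRel_subset_relations ⟨n, ρt, ρ, soloInformedCornerMove n,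
      fun _ => (-1 : ℝ) • ContinuousLinearMap.id ℝ (Fin n → ℝ),
      soloInformed_isSemialgebraicMapOn_cornerMove (isSemialgebraic_soloInformedOpenCube n),
      fun x _ => (soloInformed_hasFDerivAt_cornerMove x).hasFDerivWithinAt,
      soloInformed_cornerMove_injective.injOn, ?_, fun x hx => ?_, rfl⟩
    · show ρ.domain = soloInformedCornerMove n '' soloInformedOpenCube n
      rw [soloInformed_image_cornerMove, hρ]
    · have hx' : x ∈ soloInformedOpenCube n := hx
      show MvPolynomial.aeval x (soloInformedReflect n P) /
          MvPolynomial.aeval x (soloInformedReflect n Q) = _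
      rw [hρi (soloInformed_cornerMove_mem hx'), det_smul_id_fin, abs_pow, abs_neg, abs_one,
        one_pow, mul_one, soloInformed_aeval_reflect, soloInformed_aeval_reflect]
  have hpres := soloInformed_presentable_of_nondegenerate_rational_open (soloInformedReflect n P)
    (soloInformedReflect n Q) hND ρt rfl fun x _ => rfl
  rw [← neg_sub] at h2
  exact soloInformed_presentable_of_sub_mem (by simpa using relations.neg_mem h2) hpres

/-- The corner move inside the calculus, closed cube: `[[0,1]ⁿ, P/Q]` is presentable as soon as
`reflect Q` is cube-nondegenerate. [this work] -/
theorem soloInformed_presentable_of_reflect_nondegenerate (P Q : MvPolynomial (Fin n) ℚ)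
    (hND : SoloInformedCubeNondegenerate (soloInformedReflect n Q)) (r : IntegralRep n)
    (hr : r.domain = soloInformedCube n)
    (hri : EqOn r.integrand (fun x => MvPolynomial.aeval x P / MvPolynomial.aeval x Q)
      (soloInformedOpenCube n)) :
    of r ∈ soloInformedPresentable := by
  have hOsub : soloInformedOpenCube n ⊆ r.domain := hr ▸ soloInformedOpenCube_subset_cube n
  set r₀ := r.restrict (soloInformedOpenCube n) (isSemialgebraic_soloInformedOpenCube n) hOsub
    with hr₀
  have h₀ : of r - of r₀ ∈ relations :=
    r.of_sub_of_restrict_mem_relations (isSemialgebraic_soloInformedOpenCube n) hOsub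
      (by rw [hr]; exact soloInformed_volume_cube_diff_openCube n)
  exact soloInformed_presentable_of_sub_mem h₀
    (soloInformed_presentable_of_reflect_nondegenerate_open P Q hND r₀ rfl fun x hx => hri hx)

end Summit.KontsevichZagierPeriods.KontsevichZagierPeriods.Theorems
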